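import Mathlib
import HarnessLib

/-!
# [telescope — width x2-p2 g24, 2026-08-30] (D3) DE-ASSEMBLED: duals and reflexive hulls of finitely generated
`𝒪⟦X⟧`-modules are FREE — without Auslander–Buchsbaum

Step (D3) of the transcription of the load-bearing cited fact of crux 4's line «telescope»
(`Literature.NumberTheory.EllipticCurves.PNewBranchGaloisLattice`, module docstring) replaces Hida's lattice by the
reflexive hull of its base change to `ℤ_p⟦X⟧` and uses that a finitely generated REFLEXIVE module over the
two-dimensional regular local ring `ℤ_p⟦X⟧` is free [cite: BrunsHerzog1998, Prop. 1.4.1, Thm. 1.3.3 (Auslander–Buchsbaum)]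
(the «TU-hull» rider). This file makes that commutative algebra a TREE THEOREM by an elementary route that needs no
depth / projective dimension:

* `linearIndependent_of_lift`, `span_eq_top_of_lift` (§1): over a Noetherian ring, a finite family `m` of a finitely
  generated module `M` whose reductions modulo a NON-ZERO-DIVISOR `x` of the Jacobson radical are a basis «mod `x`» is a
  basis (Nakayama twice: for the span, and for the relation module `K`, which satisfies `K ≤ x • K` because `x` is
  `M`-regular);
* `free_dual_of_surjective` (§2): if `R` is a Noetherian domain, `φ : R ↠ S` has kernel `(x)` with `x ≠ 0` in the Jacobson
  radical and `S` is a principal ideal domain, then `Module.Dual R N = Hom_R(N, R)` is FREE for every finitely generated `N`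
  (the reduction `Hom_R(N,R)/x ↪ Sⁿ` lands in a free `S`-module, whose `S`-submodules are free);
* `free_dual_powerSeries`, `free_of_reflexive_powerSeries` (§3): the case `R = 𝒪⟦X⟧`, `x = X`, `S = 𝒪` a local PID
  (e.g. `𝒪 = ℤ_p`): duals, double duals (= reflexive hulls) and reflexive finitely generated `𝒪⟦X⟧`-modules are free.

Helper toward crux 4 [stmt …-19034] (`--supports`); it changes no registered stub, proves no cited fact about Hida's
lattice, and proves no summit statement; BSD is proved for no curve.
-/

set_option autoImplicit false
set_option linter.dupNamespace false

namespace Summit.BirchSwinnertonDyer.BirchSwinnertonDyer.Theorems.TelescopeBranchReflexiveHullFree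

/-! ### §1. Lifting a basis along a non-zero-divisor of the Jacobson radical -/

/-- If `x` lies in the Jacobson radical of a Noetherian ring `R`, `x` is a non-zero-divisor on `M`, and a finite family
`m` is linearly independent «modulo `x`» (`∑ aᵢ mᵢ ∈ x M ⇒ x ∣ aᵢ`), then `m` is linearly independent (Nakayama applied to
the relation module). [cite: BrunsHerzog1998, Prop. 1.4.1 (proof idea)] -/
theorem linearIndependent_of_lift {R M : Type*} [CommRing R] [IsNoetherianRing R] [AddCommGroup M] [Module R M]
    {x : R} (hx : Ideal.span {x} ≤ (⊥ : Ideal R).jacobson) (hreg : ∀ v : M, x • v = 0 → v = 0)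
    {ι : Type*} [Fintype ι] (m : ι → M)
    (hindep : ∀ (a : ι → R) (w : M), ∑ i, a i • m i = x • w → ∀ i, x ∣ a i) :
    LinearIndependent R m := by
  classical
  set f : (ι → R) →ₗ[R] M := Fintype.linearCombination R m with hf
  set K : Submodule R (ι → R) := LinearMap.ker f with hK
  have hKfg : K.FG := IsNoetherian.noetherian K
  have hKle : K ≤ Ideal.span {x} • K := by
    intro g hg
    have hfg : f g = 0 := hg
    have hg0 : ∑ i, g i • m i = 0 := by rw [← hfg, hf, Fintype.linearCombination_apply]
    have hdvd : ∀ i, x ∣ g i := hindep g 0 (by rw [hg0, smul_zero])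
    choose g' hg' using hdvd
    have hgx : g = x • (fun i => g' i) := by
      funext i
      rw [Pi.smul_apply, smul_eq_mul, ← hg' i]
    have hg'K : (fun i => g' i) ∈ K := by
      rw [hK, LinearMap.mem_ker]
      apply hreg
      rw [← LinearMap.map_smul, ← hgx]
      exact hfg
    rw [hgx]
    exact Submodule.smul_mem_smul (Ideal.mem_span_singleton_self x) hg'K
  have hKbot : K = ⊥ := Submodule.eq_bot_of_le_smul_of_le_jacobson_bot (Ideal.span {x}) K hKfg hKle hx
  rw [Fintype.linearIndependent_iff]
  intro g hg i
  have hgK : g ∈ K := by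
    rw [hK, LinearMap.mem_ker, hf, Fintype.linearCombination_apply]
    exact hg
  rw [hKbot, Submodule.mem_bot] at hgK
  rw [hgK, Pi.zero_apply]

/-- If `x` lies in the Jacobson radical and a finite family `m` of a finitely generated module `M` spans `M` «modulo `x`»,
then `m` spans `M` (Nakayama). [folklore] -/
theorem span_eq_top_of_lift {R M : Type*} [CommRing R] [AddCommGroup M] [Module R M] [Module.Finite R M]
    {x : R} (hx : Ideal.span {x} ≤ (⊥ : Ideal R).jacobson) {ι : Type*} [Fintype ι] (m : ι → M)
    (hspan : ∀ v : M, ∃ (a : ι → R) (w : M), v = ∑ i, a i • m i + x • w) :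
    Submodule.span R (Set.range m) = ⊤ := by
  have hfg : (⊤ : Submodule R M).FG := Module.Finite.fg_top
  refine top_le_iff.mp (Submodule.le_of_le_smul_of_le_jacobson_bot hfg hx ?_)
  intro v _
  obtain ⟨a, w, hv⟩ := hspan v
  rw [hv]
  refine Submodule.add_mem_sup (Submodule.sum_mem _ fun i _ => Submodule.smul_mem _ _ (Submodule.subset_span ⟨i, rfl⟩)) ?_
  exact Submodule.smul_mem_smul (Ideal.mem_span_singleton_self x) Submodule.mem_top

/-! ### §2. Duals of finitely generated modules are free when `R/x` is a PID -/

/-- The dual of a finitely generated module over a Noetherian ring is finitely generated. [folklore] -/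
theorem finite_dual (R N : Type*) [CommRing R] [IsNoetherianRing R] [AddCommGroup N] [Module R N] [Module.Finite R N] :
    Module.Finite R (Module.Dual R N) := by
  obtain ⟨n, π, hπ⟩ := Module.Finite.exists_fin' R N
  exact Module.Finite.of_injective π.dualMap (LinearMap.dualMap_injective_of_surjective hπ)

/-- **Duals are free.** Let `R` be a Noetherian domain, `φ : R →+* S` surjective onto a principal ideal domain with
`ker φ = (x)`, `x ≠ 0` in the Jacobson radical. Then `Hom_R(N, R)` is a free `R`-module for every finitely generated
`R`-module `N`. (For `R` regular local of dimension two this is [cite: BrunsHerzog1998, Prop. 1.4.1 with Thm. 1.3.3];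
the proof here is elementary: reduce modulo `x` into `Sⁿ` and lift an `S`-basis by §1.) -/
theorem free_dual_of_surjective {R S : Type*} [CommRing R] [IsDomain R] [IsNoetherianRing R]
    [CommRing S] [IsDomain S] [IsPrincipalIdealRing S]
    (φ : R →+* S) (hφ : Function.Surjective φ) {x : R} (hx0 : x ≠ 0) (hker : ∀ r, φ r = 0 ↔ x ∣ r)
    (hjac : Ideal.span {x} ≤ (⊥ : Ideal R).jacobson)
    (N : Type*) [AddCommGroup N] [Module R N] [Module.Finite R N] : Module.Free R (Module.Dual R N) := by
  classical
  haveI : RingHomSurjective φ := ⟨hφ⟩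
  haveI : Module.Finite R (Module.Dual R N) := finite_dual R N
  obtain ⟨n, π, hπ⟩ := Module.Finite.exists_fin' R N
  -- the reduction map `ρ f = (φ (f (π eᵢ)))ᵢ`
  let ρ : Module.Dual R N →ₛₗ[φ] (Fin n → S) :=
    { toFun := fun f i => φ (f (π (Pi.single i 1)))
      map_add' := fun f g => by
        funext i
        simp only [LinearMap.add_apply, map_add, Pi.add_apply]
      map_smul' := fun r f => by
        funext i
        simp only [LinearMap.smul_apply, smul_eq_mul, map_mul, Pi.smul_apply] }
  have hρ : ∀ (f : Module.Dual R N) (i : Fin n), ρ f i = φ (f (π (Pi.single i 1))) := fun f i => rfl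
  have hφx : φ x = 0 := (hker x).mpr dvd_rfl
  -- `ker ρ = x • Dual`
  have key : ∀ f : Module.Dual R N, ρ f = 0 → ∃ g : Module.Dual R N, f = x • g := by
    intro f hf
    have hgen : ∀ i : Fin n, x ∣ f (π (Pi.single i 1)) := fun i => (hker _).mp (by rw [← hρ, hf, Pi.zero_apply])
    have hval : ∀ v : N, ∃ c : R, f v = x * c := by
      intro v
      obtain ⟨a, rfl⟩ := hπ v
      have ha : a = ∑ i, a i • (Pi.single i 1 : Fin n → R) := by
        funext j
        simp only [Finset.sum_apply, Pi.smul_apply, Pi.single_apply, smul_eq_mul, mul_ite, mul_one, mul_zero,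
          Finset.sum_ite_eq, Finset.mem_univ, if_true]
      rw [ha, map_sum, map_sum]
      simp_rw [LinearMap.map_smul, smul_eq_mul]
      obtain ⟨c, hc⟩ := Finset.dvd_sum (s := Finset.univ) fun i _ => (hgen i).mul_left (a i)
      exact ⟨c, hc⟩
    choose c hc using hval
    have hcadd : ∀ v w, c (v + w) = c v + c w := fun v w =>
      mul_left_cancel₀ hx0 (by rw [← hc, map_add, hc, hc, mul_add])
    have hcsmul : ∀ (r : R) v, c (r • v) = r * c v := fun r v =>
      mul_left_cancel₀ hx0 (by rw [← hc, LinearMap.map_smul, hc, smul_eq_mul, mul_left_comm])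
    refine ⟨{ toFun := c, map_add' := hcadd, map_smul' := hcsmul }, ?_⟩
    ext v
    rw [LinearMap.smul_apply, smul_eq_mul]
    exact hc v
  -- the image `V ⊆ Sⁿ` is a free `S`-module; lift a basis
  let V : Submodule S (Fin n → S) := LinearMap.range ρ
  obtain ⟨k, b⟩ := Submodule.basisOfPid (Pi.basisFun S (Fin n)) V
  have hlift : ∀ j : Fin k, ∃ m : Module.Dual R N, ρ m = ((b j : V) : Fin n → S) := fun j => LinearMap.mem_range.mp (b j).2
  choose m hm using hlift
  -- §1 hypotheses
  have hreg : ∀ f : Module.Dual R N, x • f = 0 → f = 0 := by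
    intro f hf
    ext v
    have h1 : x * f v = 0 := by rw [← smul_eq_mul, ← LinearMap.smul_apply, hf, LinearMap.zero_apply]
    rw [LinearMap.zero_apply]
    exact (mul_eq_zero.mp h1).resolve_left hx0
  have hli' : LinearIndependent S (fun j => ((b j : V) : Fin n → S)) :=
    b.linearIndependent.map' V.subtype (Submodule.ker_subtype V)
  have hindep : ∀ (a : Fin k → R) (w : Module.Dual R N), ∑ j, a j • m j = x • w → ∀ j, x ∣ a j := by
    intro a w h j
    have h1 := congrArg ρ h
    rw [map_sum, map_smulₛₗ, hφx, zero_smul] at h1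
    simp_rw [map_smulₛₗ, hm] at h1
    exact (hker _).mp (Fintype.linearIndependent_iff.mp hli' (fun j => φ (a j)) h1 j)
  have hspan : ∀ f : Module.Dual R N, ∃ (a : Fin k → R) (w : Module.Dual R N), f = ∑ j, a j • m j + x • w := by
    intro f
    have hfV : ρ f ∈ V := LinearMap.mem_range_self ρ f
    have hsum : ∑ j, (b.repr ⟨ρ f, hfV⟩) j • ((b j : V) : Fin n → S) = ρ f := by
      have h1 := congrArg (Subtype.val : V → Fin n → S) (b.sum_repr ⟨ρ f, hfV⟩)
      simpa only [Submodule.coe_sum, Submodule.coe_smul] using h1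
    choose a ha using fun j => hφ ((b.repr ⟨ρ f, hfV⟩) j)
    obtain ⟨g, hg⟩ := key (f - ∑ j, a j • m j) (by
      rw [map_sub, map_sum]
      simp_rw [map_smulₛₗ, ha, hm]
      rw [hsum, sub_self])
    exact ⟨a, g, by rw [← hg, add_sub_cancel]⟩
  exact Module.Free.of_basis (Module.Basis.mk (linearIndependent_of_lift hjac hreg m hindep) (span_eq_top_of_lift hjac m hspan).ge)

/-! ### §3. The case `𝒪⟦X⟧` -/

/-- `X` generates an ideal inside the Jacobson radical of `𝒪⟦X⟧` (`𝒪` local). [folklore] -/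
theorem span_X_le_jacobson (𝒪 : Type*) [CommRing 𝒪] [IsLocalRing 𝒪] :
    Ideal.span {(PowerSeries.X : PowerSeries 𝒪)} ≤ (⊥ : Ideal (PowerSeries 𝒪)).jacobson := by
  rw [IsLocalRing.jacobson_eq_maximalIdeal ⊥ bot_ne_top, Ideal.span_le, Set.singleton_subset_iff, SetLike.mem_coe,
    IsLocalRing.mem_maximalIdeal, mem_nonunits_iff, PowerSeries.isUnit_iff_constantCoeff, PowerSeries.constantCoeff_X]
  exact not_isUnit_zero

/-- **(D3), dual form.** Over `𝒪⟦X⟧` with `𝒪` a local principal ideal domain (e.g. `𝒪 = ℤ_p`), the dual `Hom(N, 𝒪⟦X⟧)` of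
every finitely generated module `N` is free. [cite: BrunsHerzog1998, Prop. 1.4.1, Thm. 1.3.3] -/
theorem free_dual_powerSeries (𝒪 : Type*) [CommRing 𝒪] [IsDomain 𝒪] [IsPrincipalIdealRing 𝒪] [IsLocalRing 𝒪]
    (N : Type*) [AddCommGroup N] [Module (PowerSeries 𝒪) N] [Module.Finite (PowerSeries 𝒪) N] :
    Module.Free (PowerSeries 𝒪) (Module.Dual (PowerSeries 𝒪) N) :=
  free_dual_of_surjective (PowerSeries.constantCoeff (R := 𝒪)) PowerSeries.constantCoeff_surj PowerSeries.X_ne_zero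
    (fun _ => PowerSeries.X_dvd_iff.symm) (span_X_le_jacobson 𝒪) N

/-- **(D3), reflexive-hull form.** The double dual (reflexive hull) of a finitely generated `𝒪⟦X⟧`-module is free and
finitely generated. [cite: BrunsHerzog1998, Prop. 1.4.1] -/
theorem free_doubleDual_powerSeries (𝒪 : Type*) [CommRing 𝒪] [IsDomain 𝒪] [IsPrincipalIdealRing 𝒪] [IsLocalRing 𝒪]
    (N : Type*) [AddCommGroup N] [Module (PowerSeries 𝒪) N] [Module.Finite (PowerSeries 𝒪) N] :
    Module.Free (PowerSeries 𝒪) (Module.Dual (PowerSeries 𝒪) (Module.Dual (PowerSeries 𝒪) N)) ∧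
      Module.Finite (PowerSeries 𝒪) (Module.Dual (PowerSeries 𝒪) (Module.Dual (PowerSeries 𝒪) N)) := by
  haveI := finite_dual (PowerSeries 𝒪) N
  exact ⟨free_dual_powerSeries 𝒪 _, finite_dual (PowerSeries 𝒪) _⟩

/-- **(D3), reflexive form.** A finitely generated REFLEXIVE `𝒪⟦X⟧`-module (`M → M**` bijective) is free; in particular
over `ℤ_p⟦X⟧`. [cite: BrunsHerzog1998, Prop. 1.4.1, Thm. 1.3.3] -/
theorem free_of_reflexive_powerSeries (𝒪 : Type*) [CommRing 𝒪] [IsDomain 𝒪] [IsPrincipalIdealRing 𝒪] [IsLocalRing 𝒪]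
    (M : Type*) [AddCommGroup M] [Module (PowerSeries 𝒪) M] [Module.Finite (PowerSeries 𝒪) M]
    (h : Function.Bijective (Module.Dual.eval (PowerSeries 𝒪) M)) : Module.Free (PowerSeries 𝒪) M := by
  haveI := finite_dual (PowerSeries 𝒪) M
  haveI := free_dual_powerSeries 𝒪 (Module.Dual (PowerSeries 𝒪) M)
  exact Module.Free.of_equiv (LinearEquiv.ofBijective (Module.Dual.eval (PowerSeries 𝒪) M) h).symm

/-- The `ℤ_p⟦X⟧` instance used by the telescope line: reflexive finitely generated `ℤ_p⟦X⟧`-modules are free. -/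
theorem free_of_reflexive_padicInt (p : ℕ) [Fact p.Prime]
    (M : Type*) [AddCommGroup M] [Module (PowerSeries ℤ_[p]) M] [Module.Finite (PowerSeries ℤ_[p]) M]
    (h : Function.Bijective (Module.Dual.eval (PowerSeries ℤ_[p]) M)) : Module.Free (PowerSeries ℤ_[p]) M :=
  free_of_reflexive_powerSeries ℤ_[p] M h

end Summit.BirchSwinnertonDyer.BirchSwinnertonDyer.Theorems.TelescopeBranchReflexiveHullFree
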